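import Summits.KontsevichZagierPeriods.KontsevichZagierPeriods.Theorems.LinRedNormalFormArrangementNormalFormStubRebaseSimplePosOnePosQuadChart

/-!
# Stub `stub_rebaseSimplePosOnePos` (crux `ArrangementNormalForm`, line `janus-bands`) —
part `QuadForms`: the steep blow-up of a flat point, literal bookkeeping (`B = 2`)

`B = 2` corner calculus, second file: how the literal pieces of a one-fibre datum over the base
`(x₁, x₂, y)` read in the chart `RebasePos.blowQ` (`x₁ = ρ`, `x₂ = ρ/ξ`, `y = ρ η/ξ`,
`t = ρ θ/ξ`) of part `QuadChart`. Rows (`RebasePos.chartRowQ`): a linear row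
`m₀ x₁ + m₁ x₂ + m₂ y = (ρ/ξ)(m₀ ξ + m₁ + m₂ η)`, a row in `x₁` alone is unchanged, a row
`c + m₁ x₂ = (c ξ + m₁ ρ)/ξ`; linear bounds (`RebasePos.chartFQ`, `ρ`-free, same `η`-slope);
silent factors (`RebasePos.chartLQ`, with the `ρ`- and `1/ξ`-exponents `alphaQ`, `betaQ` and
their totals `expA`, `expB`); the `x₂`-homogenised numerator `RebasePos.homogQ p`
(`ξ^D p(ρ, ρ/ξ)`, `D = deg_{x₂} p`: `RebasePos.aeval_homogQ`); the sector rows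
`RebasePos.boxRowsQ ε` (`0 < x₁ < x₂ < ε`) and their images `RebasePos.outRowsQ ε`
(`ρ > 0`, `0 < ξ < 1`, `ρ < ε ξ`). The charted numerator / factor list / exponents
`chartPQ`, `chartLsQ`, `chartEsQ` feed the move of part `QuadMove`.

References: M. Kontsevich, D. Zagier, *Periods* (2001), §1.2, rule (2).
-/

noncomputable section

open Set MeasureTheory MvPolynomial
open Literature.NumberTheory.Transcendental Literature.ModelTheory.ExponentialFields

namespace Summit.KontsevichZagierPeriods.ArrangementNormalForm.JanusBands

namespace RebasePos

open SeparatePos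

section QuadMoveData

/-- A row, read in the steep chart: a linear row `m₀ x₁ + m₁ x₂ + m₂ y = (ρ/ξ)(m₀ ξ + m₁ + m₂ η)`,
a row in `x₁` alone is kept, a row `c + m₁ x₂ = (c ξ + m₁ ρ)/ξ`. -/
def chartRowQ (c : (Fin (2 + 1) → ℚ) × ℚ) : (Fin (2 + 1) → ℚ) × ℚ :=
  if c.2 = 0 then (![0, c.1 0, c.1 2], c.1 1) else if c.1 1 = 0 then c else (![c.1 1, c.2, 0], 0)

/-- A linear bound, read in the steep chart: `u = (ρ/ξ) U`, `U = u₀ ξ + u₁ + u₂ η`. -/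
def chartFQ (c : (Fin (2 + 1) → ℚ) × ℚ) : (Fin (2 + 1) → ℚ) × ℚ := (![0, c.1 0, c.1 2], c.1 1)

/-- A silent factor, read in the steep chart: linear `a x₁ + b x₂ = (ρ/ξ)(a ξ + b)`, `c + a x₁`
kept, `c + b x₂ = (c ξ + b ρ)/ξ`. -/
def chartLQ (d : (Fin 2 → ℚ) × ℚ) : (Fin 2 → ℚ) × ℚ :=
  if d.2 = 0 then (![0, d.1 0], d.1 1) else if d.1 1 = 0 then d else (![d.1 1, d.2], 0)

/-- The `ρ`-exponent of a silent factor in the chart (`1` for linear factors). -/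
def alphaQ (d : (Fin 2 → ℚ) × ℚ) : ℕ := if d.2 = 0 then 1 else 0

/-- The `1/ξ`-exponent of a silent factor in the chart (`1` unless the factor is in `x₁` alone). -/
def betaQ (d : (Fin 2 → ℚ) × ℚ) : ℕ := if d.2 = 0 then 1 else if d.1 1 = 0 then 0 else 1

/-- The four rows of the steep sector piece: `x₁ > 0`, `x₂ > 0`, `x₂ − x₁ > 0`, `ε − x₂ > 0`. -/
def boxRowsQ (ε : ℚ) : Fin 4 → (Fin (2 + 1) → ℚ) × ℚ :=
  ![(![1, 0, 0], 0), (![0, 1, 0], 0), (![-1, 1, 0], 0), (![0, -1, 0], ε)]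

/-- Their chart images: `ρ > 0`, `ξ > 0`, `1 − ξ > 0`, `ε ξ − ρ > 0`. -/
def outRowsQ (ε : ℚ) : Fin 4 → (Fin (2 + 1) → ℚ) × ℚ :=
  ![(![1, 0, 0], 0), (![0, 1, 0], 0), (![0, -1, 0], 1), (![-1, ε, 0], 0)]

/-- The coordinate form `ρ`. -/
def rhoQ : (Fin 2 → ℚ) × ℚ := (![1, 0], 0)

/-- The coordinate form `ξ`. -/
def xiQ : (Fin 2 → ℚ) × ℚ := (![0, 1], 0)

/-- The `x₂`-homogenisation of the numerator: `ξ^D p(ρ, ρ/ξ)` as a polynomial in `(ρ, ξ)`,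
`D = deg_{x₂} p`. -/
def homogQ (p : MvPolynomial (Fin 2) ℚ) : MvPolynomial (Fin 2) ℚ :=
  ∑ n ∈ p.support, C (coeff n p) * X 0 ^ (n 0 + n 1) * X 1 ^ (p.degreeOf 1 - n 1)

variable {m : ℕ}

/-- The total `ρ`-exponent of the silent factors in the chart. -/
def expA (L : Fin m → (Fin 2 → ℚ) × ℚ) (e : Fin m → ℕ) : ℕ := ∑ j, alphaQ (L j) * e j

/-- The total `1/ξ`-exponent of the silent factors in the chart. -/
def expB (L : Fin m → (Fin 2 → ℚ) × ℚ) (e : Fin m → ℕ) : ℕ := ∑ j, betaQ (L j) * e j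

/-- The numerator of the charted datum: `homogQ p · ρ^{(1 − A)⁺} · ξ^{(B − D − 2)⁺}`. -/
def chartPQ (p : MvPolynomial (Fin 2) ℚ) (L : Fin m → (Fin 2 → ℚ) × ℚ) (e : Fin m → ℕ) : MvPolynomial (Fin 2) ℚ :=
  homogQ p * X 0 ^ (1 - expA L e) * X 1 ^ (expB L e - (p.degreeOf 1 + 2))

/-- The silent factors of the charted datum: the charted factors, then `ρ`, `ξ`. -/
def chartLsQ (L : Fin m → (Fin 2 → ℚ) × ℚ) : Fin (m + 2) → (Fin 2 → ℚ) × ℚ :=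
  Fin.append (fun j => chartLQ (L j)) ![rhoQ, xiQ]

/-- Their exponents: the old ones, then `(A − 1)⁺`, `(D + 2 − B)⁺`. -/
def chartEsQ (p : MvPolynomial (Fin 2) ℚ) (L : Fin m → (Fin 2 → ℚ) × ℚ) (e : Fin m → ℕ) : Fin (m + 2) → ℕ :=
  Fin.append e ![expA L e - 1, p.degreeOf 1 + 2 - expB L e]

end QuadMoveData

section QuadMoveForms

/-- Linear rows in the steep chart (for `ρ, ξ > 0`). -/
theorem affF_blowQ_lin (c : (Fin (2 + 1) → ℚ) × ℚ) (hc : c.2 = 0) (w : Fin (2 + 1 + 1) → ℝ) (hξ : w 1 ≠ 0) :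
    affF 2 1 c (blowQ w) = w 0 / w 1 * affF 2 1 (chartFQ c) w := by
  rw [affF_three, affF_three, chartFQ, hc]
  simp only [blowQ_zero, blowQ_one, blowQ_two, Rat.cast_zero, add_zero, Matrix.cons_val_zero, zero_mul,
    Matrix.cons_val_one, zero_add, Matrix.cons_val]
  field_simp
  ring

/-- Rows of the three allowed kinds, read in the steep chart (for `ρ, ξ > 0`). -/
theorem affF_blowQ_pos_iff (c : (Fin (2 + 1) → ℚ) × ℚ)
    (hc : c.2 ≠ 0 → (c.1 1 = 0 ∧ c.1 2 = 0) ∨ (c.1 0 = 0 ∧ c.1 2 = 0))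
    (w : Fin (2 + 1 + 1) → ℝ) (hρ : 0 < w 0) (hξ : 0 < w 1) :
    0 < affF 2 1 c (blowQ w) ↔ 0 < affF 2 1 (chartRowQ c) w := by
  have hq : 0 < w 0 / w 1 := div_pos hρ hξ
  by_cases h : c.2 = 0
  · rw [chartRowQ, if_pos h, affF_blowQ_lin c h w hξ.ne', chartFQ]
    exact ⟨fun h' => pos_of_mul_pos_right h' hq.le, fun h' => mul_pos hq h'⟩
  · rcases hc h with ⟨h1, h2⟩ | ⟨h0, h2⟩
    · rw [chartRowQ, if_neg h, if_pos h1, affF_three, affF_three, h1, h2]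
      simp
    · by_cases h1 : c.1 1 = 0
      · rw [chartRowQ, if_neg h, if_pos h1, affF_three, affF_three, h0, h1, h2]
        simp
      · rw [chartRowQ, if_neg h, if_neg h1, affF_three, affF_three, h0, h2]
        simp only [blowQ_zero, blowQ_one, blowQ_two, Rat.cast_zero, zero_mul, zero_add, add_zero,
          Matrix.cons_val_zero, Matrix.cons_val_one, Matrix.cons_val]
        rw [show (c.1 1 : ℝ) * (w 0 / w 1) + (c.2 : ℝ) = (w 1)⁻¹ * ((c.1 1 : ℝ) * w 0 + (c.2 : ℝ) * w 1) by
          field_simp]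
        exact ⟨fun h' => pos_of_mul_pos_right h' (inv_pos.2 hξ).le, fun h' => mul_pos (inv_pos.2 hξ) h'⟩

/-- Silent factors of the three allowed kinds, read in the steep chart. -/
theorem affB_blowQ_eq (d : (Fin 2 → ℚ) × ℚ) (hd : d.2 ≠ 0 → d.1 1 ≠ 0 → d.1 0 = 0)
    (w : Fin (2 + 1 + 1) → ℝ) (hρ : w 0 ≠ 0) (hξ : w 1 ≠ 0) :
    affB 2 1 d (blowQ w) = w 0 ^ alphaQ d * (w 1)⁻¹ ^ betaQ d * affB 2 1 (chartLQ d) w := by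
  by_cases h : d.2 = 0
  · rw [alphaQ, betaQ, chartLQ, if_pos h, if_pos h, if_pos h, affB_three, affB_three, h]
    simp only [blowQ_zero, blowQ_one, Rat.cast_zero, add_zero, Matrix.cons_val_zero, zero_mul, Matrix.cons_val_one,
      zero_add, pow_one]
    field_simp
  · by_cases h1 : d.1 1 = 0
    · rw [alphaQ, betaQ, chartLQ, if_neg h, if_neg h, if_pos h1, if_neg h, if_pos h1, affB_three, affB_three, h1]
      simp
    · have h0 : d.1 0 = 0 := hd h h1
      rw [alphaQ, betaQ, chartLQ, if_neg h, if_neg h, if_neg h1, if_neg h, if_neg h1, affB_three, affB_three, h0]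
      simp only [blowQ_zero, blowQ_one, Rat.cast_zero, zero_mul, zero_add, Matrix.cons_val_zero, Matrix.cons_val_one,
        pow_zero, one_mul, pow_one]
      field_simp
      ring

/-- The product of the silent factors in the steep chart. -/
theorem prod_affB_blowQ_eq {m : ℕ} (L : Fin m → (Fin 2 → ℚ) × ℚ) (e : Fin m → ℕ)
    (hL : ∀ j, (L j).2 ≠ 0 → (L j).1 1 ≠ 0 → (L j).1 0 = 0)
    (w : Fin (2 + 1 + 1) → ℝ) (hρ : w 0 ≠ 0) (hξ : w 1 ≠ 0) :
    ∏ j, affB 2 1 (L j) (blowQ w) ^ e j =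
      w 0 ^ expA L e * (w 1)⁻¹ ^ expB L e * ∏ j, affB 2 1 (chartLQ (L j)) w ^ e j := by
  simp only [affB_blowQ_eq _ (hL _) w hρ hξ, mul_pow, ← pow_mul, Finset.prod_mul_distrib,
    Finset.prod_pow_eq_pow_sum, expA, expB]

/-- The coordinate forms evaluate to the coordinates. -/
theorem affB_rhoQ (w : Fin (2 + 1 + 1) → ℝ) : affB 2 1 rhoQ w = w 0 := by
  rw [affB_three, rhoQ]; simp

/-- The coordinate forms evaluate to the coordinates. -/
theorem affB_xiQ (w : Fin (2 + 1 + 1) → ℝ) : affB 2 1 xiQ w = w 1 := by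
  rw [affB_three, xiQ]; simp

/-- The homogenised numerator: `ξ^D p(ρ, ρ/ξ) = homogQ p (ρ, ξ)`. -/
theorem aeval_homogQ (p : MvPolynomial (Fin 2) ℚ) (w : Fin (2 + 1 + 1) → ℝ) (hξ : w 1 ≠ 0) :
    MvPolynomial.aeval (fun i : Fin 2 => (![w 0, w 1] : Fin 2 → ℝ) i) (homogQ p) =
      w 1 ^ p.degreeOf 1 * MvPolynomial.aeval (fun i : Fin 2 => (![w 0, w 0 / w 1] : Fin 2 → ℝ) i) p := by
  have key : ∀ n ∈ p.support,
      MvPolynomial.aeval (fun i : Fin 2 => (![w 0, w 1] : Fin 2 → ℝ) i)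
          (C (coeff n p) * X 0 ^ (n 0 + n 1) * X 1 ^ (p.degreeOf 1 - n 1)) =
        w 1 ^ p.degreeOf 1 *
          MvPolynomial.aeval (fun i : Fin 2 => (![w 0, w 0 / w 1] : Fin 2 → ℝ) i) (monomial n (coeff n p)) := by
    intro n hn
    obtain ⟨d, hd⟩ := Nat.exists_eq_add_of_le (monomial_le_degreeOf 1 hn)
    rw [hd, Nat.add_sub_cancel_left, aeval_monomial, Finsupp.prod_fintype _ _ fun i => pow_zero _, Fin.prod_univ_two]
    simp only [map_mul, map_pow, aeval_C, aeval_X, Matrix.cons_val_zero, Matrix.cons_val_one, eq_ratCast, div_pow,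
      pow_add]
    field_simp
  calc MvPolynomial.aeval (fun i : Fin 2 => (![w 0, w 1] : Fin 2 → ℝ) i) (homogQ p)
        = ∑ n ∈ p.support, MvPolynomial.aeval (fun i : Fin 2 => (![w 0, w 1] : Fin 2 → ℝ) i)
            (C (coeff n p) * X 0 ^ (n 0 + n 1) * X 1 ^ (p.degreeOf 1 - n 1)) := by rw [homogQ, map_sum]
    _ = ∑ n ∈ p.support, w 1 ^ p.degreeOf 1 *
          MvPolynomial.aeval (fun i : Fin 2 => (![w 0, w 0 / w 1] : Fin 2 → ℝ) i) (monomial n (coeff n p)) :=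
          Finset.sum_congr rfl key
    _ = w 1 ^ p.degreeOf 1 *
          MvPolynomial.aeval (fun i : Fin 2 => (![w 0, w 0 / w 1] : Fin 2 → ℝ) i) (∑ n ∈ p.support, monomial n (coeff n p)) := by
          rw [map_sum, Finset.mul_sum]
    _ = _ := by rw [← p.as_sum]

/-- The four sector rows, read in the steep chart. -/
theorem boxRowsQ_iff (ε : ℚ) (w : Fin (2 + 1 + 1) → ℝ) :
    (∀ k, 0 < affF 2 1 (boxRowsQ ε k) (blowQ w)) ↔ (∀ k, 0 < affF 2 1 (outRowsQ ε k) w) := by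
  simp only [Fin.forall_fin_succ, IsEmpty.forall_iff, and_true]
  simp [boxRowsQ, outRowsQ, affF_three]
  intro h0
  constructor
  · rintro ⟨h1, h2, h3⟩
    have hξ : 0 < w 1 := by
      rcases (div_pos_iff.1 h1) with h | h
      · exact h.2
      · exact absurd h.1 (not_lt.2 h0.le)
    refine ⟨hξ, ?_, ?_⟩
    · have : w 0 < w 0 / w 1 := by linarith
      rw [lt_div_iff₀ hξ] at this
      nlinarith
    · rw [div_lt_iff₀ hξ] at h3
      linarith
  · rintro ⟨h1, h2, h3⟩
    refine ⟨div_pos h0 h1, ?_, ?_⟩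
    · have : w 0 < w 0 / w 1 := by
        rw [lt_div_iff₀ h1]
        nlinarith
      linarith
    · rw [div_lt_iff₀ h1]
      linarith

/-- The chart rows give `ρ > 0`, `0 < ξ < 1`, `ρ < ε ξ`. -/
theorem outRowsQ_bounds (ε : ℚ) (w : Fin (2 + 1 + 1) → ℝ) (hw : ∀ k, 0 < affF 2 1 (outRowsQ ε k) w) :
    0 < w 0 ∧ 0 < w 1 ∧ w 1 < 1 ∧ w 0 < ε * w 1 := by
  have h0 := hw 0
  have h1 := hw 1
  have h2 := hw 2
  have h3 := hw 3
  simp only [outRowsQ, affF_three, Matrix.cons_val_zero, Matrix.cons_val_one, Matrix.cons_val,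
    Rat.cast_one, one_mul, Rat.cast_zero, zero_mul, add_zero, zero_add, Rat.cast_neg, neg_mul] at h0 h1 h2 h3
  exact ⟨h0, h1, by linarith, by linarith⟩

/-- The sector rows give `0 < x₁ < x₂ < ε`. -/
theorem boxRowsQ_pos (ε : ℚ) (z : Fin (2 + 1 + 1) → ℝ) (hz : ∀ k, 0 < affF 2 1 (boxRowsQ ε k) z) :
    0 < z 0 ∧ 0 < z 1 ∧ z 0 < z 1 ∧ z 1 < ε := by
  have h0 := hz 0
  have h1 := hz 1
  have h2 := hz 2
  have h3 := hz 3
  simp only [boxRowsQ, affF_three, Matrix.cons_val_zero, Matrix.cons_val_one, Matrix.cons_val, Rat.cast_one, one_mul,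
    Rat.cast_zero, zero_mul, add_zero, zero_add, Rat.cast_neg, neg_mul] at h0 h1 h2 h3
  exact ⟨h0, h1, by linarith, by linarith⟩

/-- Membership in a literal one-fibre domain with appended rows, over the base `(x₁, x₂, y)`. -/
theorem mem_gDom_append₂ {k k' : ℕ} (N : Fin k → (Fin (2 + 1) → ℚ) × ℚ)
    (N' : Fin k' → (Fin (2 + 1) → ℚ) × ℚ) (U V : (Fin (2 + 1) → ℚ) × ℚ) (z : Fin (2 + 1 + 1) → ℝ) :
    z ∈ gDom 2 1 (k + k') (Fin.append N N') (fun _ => Sum.inr U) (fun _ => Sum.inr V) ↔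
      ((∀ j, 0 < affF 2 1 (N j) z) ∧ ∀ j, 0 < affF 2 1 (N' j) z) ∧
        affF 2 1 U z < z 3 ∧ z 3 < affF 2 1 V z := by
  rw [mem_gDom_one, Fin.forall_fin_add, jt_eq]
  simp only [Fin.append_left, Fin.append_right]

end QuadMoveForms


end RebasePos

/-- **Registered part of `stub_rebaseSimplePosOnePos` (line `janus-bands`, `B = 2` corner
calculus): the homogenised numerator in the steep chart.** For `ξ ≠ 0`,
`ξ^{deg_{x₂} p} · p(ρ, ρ/ξ) = (RebasePos.homogQ p)(ρ, ξ)`: the numerator of a literal datum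
stays a polynomial in the silent chart coordinates `(ρ, ξ)` (`RebasePos.aeval_homogQ`). -/
theorem rebaseSimplePos_aevalHomogQ (p : MvPolynomial (Fin 2) ℚ) (w : Fin (2 + 1 + 1) → ℝ) (hξ : w 1 ≠ 0) : MvPolynomial.aeval (fun i : Fin 2 => (![w 0, w 1] : Fin 2 → ℝ) i) (RebasePos.homogQ p) = w 1 ^ p.degreeOf 1 * MvPolynomial.aeval (fun i : Fin 2 => (![w 0, w 0 / w 1] : Fin 2 → ℝ) i) p :=
  RebasePos.aeval_homogQ p w hξ

end Summit.KontsevichZagierPeriods.ArrangementNormalForm.JanusBands
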